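import Mathlib
import HarnessLib
import Literature.Analysis.FluidPDE.Tao2016AveragedNS.LocalCascadeSolutions
import Literature.Analysis.FluidPDE.Tao2016AveragedNS.RenormalisedCascadeWaves
import Literature.Analysis.FluidPDE.Tao2016AveragedNS.ViscousEternalSolutions
import Literature.Analysis.FluidPDE.Tao2016AveragedNS.BoundedEternalSolutions
import Summits.NavierStokesRegularity.NavierStokesRegularity.Theorems.TaoLadderRungTwoBreakEternalRigidityViscBddOneDefs
import Summits.NavierStokesRegularity.NavierStokesRegularity.Theorems.TaoLadderRungTwoBreakEternalRigidityViscBddOneFiringFloor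

/-!
# Crux `TaoLadderRungTwoBreak.EternalRigidityViscBddOne` (stmt-NavierStokesRegularity-20420): the DATUM FLOOR of a viscous
# blow-up — small one-shell data (relative to `ν`) never blow up, so both open stubs (ω3) `stub_typeOne` and (ω4)
# `stub_eternalLimitViscBdd` hold on the small-datum class (vacuously)

MODEL lattice ODEs only (Tao 2016 §4: the exact NS-scaled `ν`-viscous cascade lattice of a table of `InTableClass R`, `m = 4`, from a
one-shell datum, in the registered vocabulary `ViscousUpTo` / `BlowsUpAt` / `TypeOne` of the skeleton `85fbfe8e90eea58b`); nothing
here is a statement about the Navier–Stokes equations; no stub, crux or summit is closed (`--supports stmt-NavierStokesRegularity-20420`).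

The tree's FIRING FLOOR (`EternalRigidityViscBddOne.FiringFloor.everyShellFires_of_blowup`: every regular `ν`-trajectory that blows up
excites EVERY shell `n ≥ 0` to `(1+ε₀)ⁿ‖X_n(t)‖² ≥ c₀ν²`) and the tree's ENERGY BOUND (`shellEnergy_le_datum_of_viscousUpTo`:
`‖X_k(t)‖² ≤ Σᵢ X₀ᵢ²` along every regular trajectory) combine, at the datum shell `n = 0`, into:

* `datumFloor_of_blowsUpAt` — **a blow-up needs a charged datum**: `ViscousUpTo ε₀ ν α X₀ X t⋆ ∧ BlowsUpAt ε₀ X t⋆ ⟹ c₀ ν² ≤ Σᵢ X₀ᵢ²`,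
  with the table's firing constant `c₀ = c₀(ε₀, α) > 0` (independent of the datum, of `ν` and of the trajectory);
* `not_blowsUpAt_of_smallDatum` — **SMALL DATA NEVER BLOW UP**: `Σᵢ X₀ᵢ² < c₀ ν²` ⟹ no regular `ν`-trajectory from `X₀` blows up at any
  `t⋆` (a statement about EVERY `ViscousUpTo` trajectory, complementing the EXISTENCE theorem `BlowupRigidityOne.SmallData.
  exists_viscousGlobal_of_smallDatum`; scale-free reading: what matters is `|X₀|/ν`);
* `typeOne_of_smallDatum` / `eternalLimitViscBdd_of_smallDatum` / `stubs_of_smallDatum` — the registered conclusions of (ω3) and (ω4)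
  on the small-datum class, vacuously (there is no blow-up to be type I / to extract from).

READING for ⟨20420⟩ (repair census, kernel-precise): the open stubs (ω3)/(ω4) concern only data with `Σᵢ X₀ᵢ² ≥ c₀(ε₀, α) ν²`; on that
class they remain the a=1 ENVELOPE ∧ FIRED-CLOCK estimates of `eternalRigidityViscBddOne_of_envelope_firedClock`.  HONEST LABEL: a
three-line corollary of landed theorems; (ω3), (ω4), ⟨20420⟩ and every NS statement remain OPEN; rung 0.
-/

noncomputable section

-- the summit and its single sub-problem share the name (CONVENTIONS §1)
set_option linter.dupNamespace false

namespace Summit.NavierStokesRegularity.NavierStokesRegularity.Theorems.EternalRigidityViscBddOne.SmallDatum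

open Set
open Literature.Analysis.FluidPDE Literature.Analysis.FluidPDE.TaoCascade
open Summit.NavierStokesRegularity.NavierStokesRegularity.Theorems.EternalRigidityViscBddOne.Birth
open Summit.NavierStokesRegularity.NavierStokesRegularity.Theorems.EternalRigidityViscBddOne.FiringFloor

/-- **The datum floor of a viscous blow-up.**  For every `ε₀ > 0` and every table of `InTableClass R` (`R ≥ 1`) there is `c₀ > 0` (the
table's firing constant) such that, for every `ν > 0`, every regular trajectory of the exact `ν`-viscous lattice from the one-shell
datum `X₀` that blows up at some `t⋆` has `c₀ ν² ≤ Σᵢ X₀ᵢ²`: the firing floor at the datum shell against the energy bound.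
[cite: Tao2016AveragedNS, §4 (4.3), Lemma 4.1 (4.5), (4.11), the viscous equation before Thm. 4.2; tree `everyShellFires_of_blowup`,
`shellEnergy_le_datum`] -/
theorem datumFloor_of_blowsUpAt {R ε₀ : ℝ} (hR : 1 ≤ R) (hε₀ : 0 < ε₀)
    {α : Fin 4 → Fin 4 → Fin 4 → ℤ × ℤ × ℤ → ℝ} (hα : InTableClass R α) :
    ∃ c₀ : ℝ, 0 < c₀ ∧ ∀ (X₀ : Fin 4 → ℝ) (ν : ℝ), 0 < ν →
      ∀ (X : Fin 4 → ℤ → ℝ → ℝ) (tStar : ℝ), ViscousUpTo ε₀ ν α X₀ X tStar → BlowsUpAt ε₀ X tStar →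
        c₀ * ν ^ 2 ≤ ∑ i : Fin 4, X₀ i ^ 2 := by
  obtain ⟨c₀, hc₀, hfires⟩ := everyShellFires_of_blowup ε₀ hε₀ R hR α hα
  refine ⟨c₀, hc₀, fun X₀ ν hν X tStar hV hB => ?_⟩
  have hT : 0 < tStar := hV.pos
  obtain ⟨Z, hZX, hcdZ, hinitZ, hlowZ, hmotZ, hregZ⟩ := zeroNeg_clauses hV
  have hblowZ : ∀ M : ℝ, ∃ t : ℝ, 0 ≤ t ∧ t < tStar ∧
      ∃ (i : Fin 4) (n : ℤ), M < (1 + (1 + ε₀) ^ ((10 : ℝ) * n)) * |Z i n t| := by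
    intro M
    obtain ⟨t, ht0, htT, i, n, hlt⟩ := hB M
    exact ⟨t, ht0, htT, i, n, by rw [hZX i n t ht0 htT]; exact hlt⟩
  obtain ⟨t, ht0, htT, hle⟩ := hfires X₀ ν tStar Z hν hT hcdZ hinitZ hlowZ hmotZ hregZ hblowZ 0 le_rfl
  have hsv : shellVec Z 0 t = shellVec X 0 t := by
    ext j; rw [shellVec_apply, shellVec_apply, hZX j 0 t ht0 htT]
  have hE := shellEnergy_le_datum_of_viscousUpTo hε₀ hν hα hV 0 t ht0 htT
  rw [zpow_zero, one_mul, hsv] at hle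
  exact hle.trans hE

/-- **Small one-shell data never blow up.**  With the table's firing constant `c₀` of `datumFloor_of_blowsUpAt`: if `Σᵢ X₀ᵢ² < c₀ ν²`
then NO regular trajectory of the exact `ν`-viscous lattice from `X₀` blows up (`¬ BlowsUpAt ε₀ X t⋆` for every
`ViscousUpTo ε₀ ν α X₀ X t⋆`).  Scale-free: the class is `|X₀| < √c₀ · ν`.
[cite: Tao2016AveragedNS, §4 (4.3), Lemma 4.1 (4.5), (4.11), the viscous equation before Thm. 4.2] -/
theorem not_blowsUpAt_of_smallDatum {R ε₀ : ℝ} (hR : 1 ≤ R) (hε₀ : 0 < ε₀)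
    {α : Fin 4 → Fin 4 → Fin 4 → ℤ × ℤ × ℤ → ℝ} (hα : InTableClass R α) :
    ∃ c₀ : ℝ, 0 < c₀ ∧ ∀ (X₀ : Fin 4 → ℝ) (ν : ℝ), 0 < ν → (∑ i : Fin 4, X₀ i ^ 2) < c₀ * ν ^ 2 →
      ∀ (X : Fin 4 → ℤ → ℝ → ℝ) (tStar : ℝ), ViscousUpTo ε₀ ν α X₀ X tStar → ¬ BlowsUpAt ε₀ X tStar := by
  obtain ⟨c₀, hc₀, hfloor⟩ := datumFloor_of_blowsUpAt hR hε₀ hα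
  exact ⟨c₀, hc₀, fun X₀ ν hν hsmall X tStar hV hB => absurd (hfloor X₀ ν hν X tStar hV hB) (not_le.2 hsmall)⟩

/-- **(ω3) on the small-datum class** (vacuously): below the datum floor every blowing-up regular trajectory is type I — because there
is none.  The registered conclusion `TypeOne ε₀ X t⋆` of `stub_typeOne`, for data with `Σᵢ X₀ᵢ² < c₀ ν²`.
[cite: Tao2016AveragedNS, §4 Thm. 4.2 (statement shape), Lemma 4.1 (4.5); cell vocabulary] -/
theorem typeOne_of_smallDatum {R ε₀ : ℝ} (hR : 1 ≤ R) (hε₀ : 0 < ε₀)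
    {α : Fin 4 → Fin 4 → Fin 4 → ℤ × ℤ × ℤ → ℝ} (hα : InTableClass R α) :
    ∃ c₀ : ℝ, 0 < c₀ ∧ ∀ (X₀ : Fin 4 → ℝ) (ν : ℝ), 0 < ν → (∑ i : Fin 4, X₀ i ^ 2) < c₀ * ν ^ 2 →
      ∀ (X : Fin 4 → ℤ → ℝ → ℝ) (tStar : ℝ), ViscousUpTo ε₀ ν α X₀ X tStar → BlowsUpAt ε₀ X tStar →
        TypeOne ε₀ X tStar := by
  obtain ⟨c₀, hc₀, hno⟩ := not_blowsUpAt_of_smallDatum hR hε₀ hα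
  exact ⟨c₀, hc₀, fun X₀ ν hν hsmall X tStar hV hB => absurd hB (hno X₀ ν hν hsmall X tStar hV)⟩

/-- **(ω4) on the small-datum class** (vacuously): below the datum floor every type-I blowing-up regular trajectory has a uniformly
bounded, forward-(S₁)-surviving admissible viscous eternal ω-limit — because there is no blow-up.  The registered conclusion of
`stub_eternalLimitViscBdd`, for data with `Σᵢ X₀ᵢ² < c₀ ν²`.
[cite: Tao2016AveragedNS, §4 Thm. 4.2 (statement shape), Lemma 4.1 (4.5), §6.4; cell vocabulary] -/
theorem eternalLimitViscBdd_of_smallDatum {R ε₀ : ℝ} (hR : 1 ≤ R) (hε₀ : 0 < ε₀)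
    {α : Fin 4 → Fin 4 → Fin 4 → ℤ × ℤ × ℤ → ℝ} (hα : InTableClass R α) :
    ∃ c₀ : ℝ, 0 < c₀ ∧ ∀ (X₀ : Fin 4 → ℝ) (ν : ℝ), 0 < ν → (∑ i : Fin 4, X₀ i ^ 2) < c₀ * ν ^ 2 →
      ∀ (X : Fin 4 → ℤ → ℝ → ℝ) (tStar : ℝ), ViscousUpTo ε₀ ν α X₀ X tStar → BlowsUpAt ε₀ X tStar →
        TypeOne ε₀ X tStar →
          ∃ (νh : ℝ) (W : ℤ → ℝ → Em 4), IsEternalVisc ε₀ νh α W ∧ UniformBound W ∧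
            EternalSurvivingFwd 1 ε₀ W := by
  obtain ⟨c₀, hc₀, hno⟩ := not_blowsUpAt_of_smallDatum hR hε₀ hα
  exact ⟨c₀, hc₀, fun X₀ ν hν hsmall X tStar hV hB _ => absurd hB (hno X₀ ν hν hsmall X tStar hV)⟩

/-- **Both open stubs of ⟨20420⟩ on the small-datum class, in the binder order of the registered skeleton** (every `R ≥ 1`, EVERY
`ε₀ > 0` — no threshold needed — every table of `InTableClass R`; the firing constant `c₀ = c₀(ε₀, α)` is chosen before the datum, the
viscosity and the trajectory): for `Σᵢ X₀ᵢ² < c₀ ν²` the conclusions of `stub_typeOne` AND `stub_eternalLimitViscBdd` hold.  What is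
left of (ω3)/(ω4) is the charged-datum class `Σᵢ X₀ᵢ² ≥ c₀ ν²`.
[cite: Tao2016AveragedNS, §4 Thm. 4.2 (statement shape), Lemma 4.1 (4.5), §6.4; cell vocabulary] -/
theorem stubs_of_smallDatum :
    ∀ R : ℝ, 1 ≤ R → ∀ ε₀ : ℝ, 0 < ε₀ →
      ∀ (α : Fin 4 → Fin 4 → Fin 4 → ℤ × ℤ × ℤ → ℝ), InTableClass R α →
        ∃ c₀ : ℝ, 0 < c₀ ∧ ∀ (X₀ : Fin 4 → ℝ) (ν : ℝ), 0 < ν → (∑ i : Fin 4, X₀ i ^ 2) < c₀ * ν ^ 2 →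
          ∀ (X : Fin 4 → ℤ → ℝ → ℝ) (tStar : ℝ), ViscousUpTo ε₀ ν α X₀ X tStar → BlowsUpAt ε₀ X tStar →
            TypeOne ε₀ X tStar ∧
              ∃ (νh : ℝ) (W : ℤ → ℝ → Em 4), IsEternalVisc ε₀ νh α W ∧ UniformBound W ∧
                EternalSurvivingFwd 1 ε₀ W := by
  intro R hR ε₀ hε₀ α hα
  obtain ⟨c₀, hc₀, hno⟩ := not_blowsUpAt_of_smallDatum hR hε₀ hα
  exact ⟨c₀, hc₀, fun X₀ ν hν hsmall X tStar hV hB => absurd hB (hno X₀ ν hν hsmall X tStar hV)⟩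

end Summit.NavierStokesRegularity.NavierStokesRegularity.Theorems.EternalRigidityViscBddOne.SmallDatum

end
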